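import Literature.Geometry.ComplexAnalytic.PhamBrieskornJoinRankBase
import Literature.Geometry.ComplexAnalytic.PhamBrieskornFibreSymmetries
import HarnessLib

/-!
# The Milnor number of the cyclic node `z₀² + z₁² + z₂^p` is `p − 1`: `dim H₂(F; ℂ) = p − 1` for its Milnor
# fibre (Milnor 1968 Thm. 9.1; the `(k−1)`-dimensional vanishing space of Carlson–Toledo 1999 §6)

Milnor, *Singular points of complex hypersurfaces* (1968), Thm. 9.1: for `f = z₁^{a₁} + ⋯ + z_m^{a_m}` "the middle
Betti number of the fiber `F` is `(a₁ − 1)(a₂ − 1)⋯(a_m − 1)`"; Carlson–Toledo, Duke Math. J. 97 (1999) §6: for the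
degeneration (kdoublept) `y^k = x₁² + x₂²` of a `k`-fold cyclic cover "the space of vanishing cycles `V` […] is
`(k−1)`-dimensional". This file assembles, for the local model `a = (2, 2, p)` (`cyclicNodeExponents p`) of the
`A_{p−1}` point of a `p`-cyclic cover of the plane branched along a one-nodal curve, the recursion of
`PhamBrieskornJoinRankStep` (three factors) over the base of `PhamBrieskornJoinRankBase` (two factors):

* `finrank_singularHomology_join_cyclicNode` — `dim H₂(Ω₂ * Ω₂ * Ω_p; ℂ) = p − 1` (and finite-dimensionality);
* **`finrank_singularHomology_fibre_cyclicNode` — `dim H₂(F; ℂ) = p − 1` for the Milnor fibre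
  `F = {z₀² + z₁² + z₂^p = 1}`** (Milnor Lemma 9.2: `J ↪ F` is a homotopy equivalence), with
  `finite_singularHomology_fibre_cyclicNode`.

With `PhamBrieskornFibreSymmetries` (the covering rotation has no invariant vector on `H₂(F)`; the model monodromy
acts as the covering rotation) this is the complete HOMOLOGICAL local model of programme I2 — the discharge of the
cited Picard–Lefschetz fact `carlsonToledo1999_nodalMeridianMonodromy_isCyclicReflection` of crux K1 of route
`Summits/HodgeConjecture/HodgeConjecture/Theses/CyclicUnitaryPowers.lean` — short of the intersection form and of the
localisation of the monodromy of a projective degeneration. Everything is proved; no definition, no named fact.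

## References

* [Milnor1968] J. Milnor, Singular Points of Complex Hypersurfaces, Ann. of Math. Studies 61 (1968), §9,
  Thm. 9.1, Lemma 9.2 and p. 77.
* [CarlsonToledo1999] J. A. Carlson, D. Toledo, Discriminant complements and kernels of monodromy
  representations, Duke Math. J. 97 (1999), §6 (kdoublept) (held text p0013).
-/

noncomputable section

open Complex ContinuousMap Set Filter CategoryTheory Limits
open Literature.AlgebraicTopology.SingularHomology
open scoped unitInterval Topology

namespace Literature.Geometry.ComplexAnalytic

namespace PhamBrieskorn

section CyclicNode

variable (p : ℕ)

/-- The first two exponents of the model, i.e. `Fin.init (2, 2, p) = (2, 2)`, are non-zero.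
[cite: CarlsonToledo1999, §6 (kdoublept) (held text p0013)] -/
theorem init_cyclicNodeExponents_ne_zero (i : Fin (0 + 2)) : Fin.init (cyclicNodeExponents p) i ≠ 0 := by
  fin_cases i <;> exact two_ne_zero

/-- `(2, 2, p)` read at `Fin.last 2` is `p`, at the initial coordinates `2`. [cite: CarlsonToledo1999, §6 (kdoublept) (held text p0013)] -/
theorem init_cyclicNodeExponents_apply (i : Fin (0 + 2)) : Fin.init (cyclicNodeExponents p) i = 2 := by
  fin_cases i <;> rfl

/-- **`dim H₁(Ω₂ * Ω₂; ℂ) = 1`** (the join of two pairs of points is a circle): the base of the recursion at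
`(2, 2)`. [cite: Milnor1968, §9 Thm. 9.1] -/
theorem finrank_singularHomology_join_init_cyclicNode
    [Fintype (Omega (Fin.init (cyclicNodeExponents p) (Fin.last (0 + 1))))] :
    Module.finrank ℂ (singularHomology ℂ ℂ (join (Fin.init (cyclicNodeExponents p))) (0 + 1)) = 1 := by
  rw [finrank_singularHomology_join_two (init_cyclicNodeExponents_ne_zero p),
    card_Omega (init_cyclicNodeExponents_ne_zero p _), init_cyclicNodeExponents_apply,
    init_cyclicNodeExponents_apply]

/-- `H₂` of the join `Ω₂ * Ω₂ * Ω_p` is finite-dimensional (`p ≠ 0`). [cite: Milnor1968, §9 Thm. 9.1] -/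
theorem finite_singularHomology_join_cyclicNode (hp : p ≠ 0)
    [Fintype (Omega (cyclicNodeExponents p (Fin.last (1 + 1))))] :
    Module.Finite ℂ (singularHomology ℂ ℂ (join (cyclicNodeExponents p)) (1 + 1)) := by
  classical
  haveI : Fintype (Omega (Fin.init (cyclicNodeExponents p) (Fin.last (0 + 1)))) :=
    (finite_Omega (init_cyclicNodeExponents_ne_zero p _)).fintype
  haveI := finite_singularHomology_join_two (init_cyclicNodeExponents_ne_zero p)
  exact finite_singularHomology_join_succ (cyclicNodeExponents_ne_zero p hp) one_ne_zero

/-- **`dim H₂(Ω₂ * Ω₂ * Ω_p; ℂ) = p − 1`** (Milnor's recursion over the base `dim H₁(Ω₂ * Ω₂) = 1`).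
[cite: Milnor1968, §9 Thm. 9.1 and p. 77] -/
theorem finrank_singularHomology_join_cyclicNode (hp : p ≠ 0)
    [Fintype (Omega (cyclicNodeExponents p (Fin.last (1 + 1))))] :
    Module.finrank ℂ (singularHomology ℂ ℂ (join (cyclicNodeExponents p)) (1 + 1)) = p - 1 := by
  classical
  haveI : Fintype (Omega (Fin.init (cyclicNodeExponents p) (Fin.last (0 + 1)))) :=
    (finite_Omega (init_cyclicNodeExponents_ne_zero p _)).fintype
  haveI := finite_singularHomology_join_two (init_cyclicNodeExponents_ne_zero p)
  rw [finrank_singularHomology_join_succ (cyclicNodeExponents_ne_zero p hp) one_ne_zero,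
    finrank_singularHomology_join_init_cyclicNode, mul_one,
    card_Omega (m := cyclicNodeExponents p (Fin.last (1 + 1))) hp]
  rfl

/-- `H₂` of the Milnor fibre `F = {z₀² + z₁² + z₂^p = 1}` is finite-dimensional (`p ≠ 0`).
[cite: Milnor1968, §9 Thm. 9.1 and Lemma 9.2] -/
theorem finite_singularHomology_fibre_cyclicNode (hp : p ≠ 0) :
    Module.Finite ℂ (singularHomology ℂ ℂ (fibre (cyclicNodeExponents p)) 2) := by
  classical
  haveI : Fintype (Omega (cyclicNodeExponents p (Fin.last (1 + 1)))) := (finite_Omega hp).fintype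
  haveI : Module.Finite ℂ (singularHomology ℂ ℂ (join (cyclicNodeExponents p)) (1 + 1)) :=
    finite_singularHomology_join_cyclicNode p hp
  exact Module.Finite.equiv
    (singularHomology.isoOfHomotopyEquiv ℂ ℂ
      (joinHomotopyEquivFibre (cyclicNodeExponents p) (cyclicNodeExponents_ne_zero p hp)) 2).toLinearEquiv

/-- **The Milnor number of the cyclic node: `dim H₂(F; ℂ) = p − 1`** for the Milnor fibre
`F = {z₀² + z₁² + z₂^p = 1}` of `z₀² + z₁² + z₂^p` (`p ≠ 0`) — Carlson–Toledo's "`(k−1)`-dimensional" space of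
vanishing cycles of the degeneration (kdoublept) of a `k`-fold cyclic cover. [cite: Milnor1968, §9 Thm. 9.1 and Lemma 9.2]
[cite: CarlsonToledo1999, §6 (held text p0013)] -/
theorem finrank_singularHomology_fibre_cyclicNode (hp : p ≠ 0) :
    Module.finrank ℂ (singularHomology ℂ ℂ (fibre (cyclicNodeExponents p)) 2) = p - 1 := by
  classical
  haveI : Fintype (Omega (cyclicNodeExponents p (Fin.last (1 + 1)))) := (finite_Omega hp).fintype
  rw [← finrank_singularHomology_join_cyclicNode p hp]
  exact ((singularHomology.isoOfHomotopyEquiv ℂ ℂ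
    (joinHomotopyEquivFibre (cyclicNodeExponents p) (cyclicNodeExponents_ne_zero p hp)) 2).toLinearEquiv).symm.finrank_eq

end CyclicNode

end PhamBrieskorn

end Literature.Geometry.ComplexAnalytic

end
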